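import Literature.AlgebraicGeometry.Resolution.BlowupsFlatBaseChange
import Literature.AlgebraicGeometry.Resolution.BlowupsIntegral
import Literature.AlgebraicGeometry.Resolution.BlowupsExistence
import Literature.AlgebraicGeometry.Resolution.BlowupsProperProofs
import Literature.AlgebraicGeometry.Resolution.AlterationsDescentStage
import Literature.AlgebraicGeometry.Resolution.ResolutionGlue
import Summits.ResolutionOfSingularities.ResolutionOfSingularities.Theses.RisoStrata

/-!
# `RisoStrata.DescentAlgclosedToPerfect` (stmt-ResolutionOfSingularities-0550): blow-up resolutions
# along ideals defined over the base DESCEND along flat surjective base change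

Route `ResolutionOfSingularities/RisoStrata` (crux shared verbatim with Descent, UniformComplexity,
EquisingularLift, TropicalLinks, AbhyankarShadows, TeissierJung), crux `DescentAlgclosedToPerfect`
(resolution over algebraically closed fields of characteristic `p` ⇒ over perfect fields).

The only printed mechanism for the crux is Galois descent of a Galois-STABLE resolution (Kollár 2007,
3.34.2 / Thm. 3.36; Bierstone–Grigoriev–Milman–Włodarczyk 2011, Remark p. 23). This file proves the
half of that mechanism which needs no group action and no canonicity, in the form every line through
the crux consumes:

* `hasResolution_of_isBlowup_comap` — if `X` is integral and locally Noetherian, `ι : S → X` is FLAT and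
  SURJECTIVE (e.g. `X ×_k K → X` for any field extension `K/k`), `J ≠ 0` is an ideal sheaf ON `X`, and
  the blow-up of `S` along the pulled-back ideal `J·𝒪_S` is regular, then `X` has a resolution — namely
  its own blow-up along `J`: blow-ups commute with flat base change (`IsBlowup.pullback_snd_of_flat`,
  Görtz–Wedhorn 13.91 (2)), so `Bl_J X ×_X S ≅ Bl_{J𝒪_S} S` is regular, and regularity descends along
  the flat surjection `Bl_J X ×_X S → Bl_J X` (Matsumura 23.7 (i), `isRegular_of_flat_surjective`);
  `Bl_J X → X` is proper (Stacks 02NS, proved in tree) and birational (`J ≠ 0`, Stacks 02ND).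
* `hasResolution_of_isBlowup_comap_fieldExtension` — the case `S = X ×_k K`, `K/k` any extension of
  fields: **a resolution of `X_K` which is the blow-up of an ideal sheaf coming from `X` descends to a
  resolution of `X`**. Hence the crux is EXACTLY the existence, for `X` integral separated of finite
  type over a perfect `k`, of a `k`-RATIONAL resolving ideal (for `K/k` Galois: a Galois-invariant one,
  by Galois descent of quasi-coherent ideals) — bare existence of a resolution of `X_K` gives an
  ideal on `X_K` only, and the norm of its conjugates gives domination, not regularity (the recorded
  stall of route Descent; card `descent-is-domination-sandwiched-principalization`).
-/

noncomputable section

set_option linter.dupNamespace false -- mandated namespace of this single-conjunct summit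

open CategoryTheory CategoryTheory.Limits AlgebraicGeometry
open Literature.AlgebraicGeometry.Resolution

namespace Summit.ResolutionOfSingularities.ResolutionOfSingularities.Theorems

universe u

/-- **Blow-up resolutions along ideals of the base descend along flat surjective base change.**
Let `X` be integral and locally Noetherian, `ι : S ⟶ X` flat and surjective, `J ≠ ⊥` an ideal sheaf
on `X`, and `ρ : Y ⟶ S` a blow-up of `S` along `J·𝒪_S = J.comap ι` with `Y` regular. Then `X` admits
a resolution of singularities (its blow-up along `J`). Blow-ups commute with flat base change, so
`Bl_J X ×_X S` is a blow-up of `S` along `J·𝒪_S`, hence isomorphic to `Y` and regular; regularity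
descends along the flat surjection `Bl_J X ×_X S ⟶ Bl_J X` (Matsumura 23.7 (i)); `Bl_J X ⟶ X` is
proper (Stacks 02NS) and birational (Stacks 02ND, `J ≠ 0` on the integral `X`).
[cite: GortzWedhorn2020, Prop. 13.91 (2); Matsumura1987, Thm. 23.7 (i); StacksProject, Tag 02NS] -/
theorem hasResolution_of_isBlowup_comap {X S Y : Scheme.{u}} [IsIntegral X] [IsLocallyNoetherian X]
    (ι : S ⟶ X) [Flat ι] [Surjective ι] {J : X.IdealSheafData} (hJ : J ≠ ⊥) {ρ : Y ⟶ S}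
    (hρ : IsBlowup ρ (J.comap ι)) (hY : Scheme.IsRegular Y) : Scheme.HasResolution X := by
  obtain ⟨X', π, hπ⟩ := exists_isBlowup X J
  -- `X' ×_X S ⟶ S` is a blow-up along `J·𝒪_S`, hence isomorphic to `Y`
  have hbc : IsBlowup (pullback.snd π ι) (J.comap ι) := hπ.pullback_snd_of_flat ι
  obtain ⟨e, -, -⟩ := hρ.unique hbc
  have hP : Scheme.IsRegular (pullback π ι) := hY.of_iso e.hom
  -- `X'` is locally Noetherian (the blow-up is proper, in particular locally of finite type)
  haveI : IsProper π := stacks02NS_holds.of_isLocallyNoetherian π J hπ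
  haveI : IsLocallyNoetherian X' := LocallyOfFiniteType.isLocallyNoetherian π
  -- regularity descends along the flat surjection `X' ×_X S ⟶ X'`
  haveI : Flat (pullback.fst π ι) := MorphismProperty.pullback_fst _ _ ‹Flat ι›
  haveI : Surjective (pullback.fst π ι) := MorphismProperty.pullback_fst _ _ ‹Surjective ι›
  have hX' : Scheme.IsRegular X' :=
    DeJong1996.Stage.isRegular_of_flat_surjective (pullback.fst π ι) hP
  exact ⟨X', π, hπ.isResolution' stacks02NS_holds hJ hX'⟩

/-- **A resolution of `X_K` by the blow-up of an ideal sheaf defined over `k` descends to `X`.**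
Let `k ⊆ K` be any extension of fields, `f : X ⟶ Spec k` with `X` integral and locally Noetherian
(e.g. locally of finite type), `J ≠ ⊥` an ideal sheaf on `X`, and suppose the blow-up of
`X_K = X ×_k K` along `J·𝒪_{X_K}` is regular. Then `X` has a resolution of singularities. (The base
change `X_K ⟶ X` of the fpqc cover `Spec K ⟶ Spec k` is flat and surjective.) This is the
action-free half of Galois descent of resolutions (Kollár 2007, 3.34.2; BGMW 2011, Remark p. 23):
what remains of crux `DescentAlgclosedToPerfect` is a `k`-rational resolving ideal.
[cite: Kollar2007, 3.34.2 p. 131; GortzWedhorn2020, Prop. 13.91 (2); Matsumura1987, Thm. 23.7 (i)] -/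
theorem hasResolution_of_isBlowup_comap_fieldExtension {k K : Type u} [Field k] [Field K]
    (σ : k →+* K) {X Y : Scheme.{u}} (f : X ⟶ Spec (.of k)) [IsIntegral X] [IsLocallyNoetherian X]
    {J : X.IdealSheafData} (hJ : J ≠ ⊥)
    {ρ : Y ⟶ pullback f (Spec.map (CommRingCat.ofHom σ))}
    (hρ : IsBlowup ρ (J.comap (pullback.fst f (Spec.map (CommRingCat.ofHom σ)))))
    (hY : Scheme.IsRegular Y) : Scheme.HasResolution X := by
  haveI : Flat (Spec.map (CommRingCat.ofHom σ)) := DeJong1996.Stage.flat_specMap σ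
  haveI : Surjective (Spec.map (CommRingCat.ofHom σ)) := DeJong1996.Stage.surjective_specMap σ
  haveI : Flat (pullback.fst f (Spec.map (CommRingCat.ofHom σ))) :=
    MorphismProperty.pullback_fst _ _ ‹_›
  haveI : Surjective (pullback.fst f (Spec.map (CommRingCat.ofHom σ))) :=
    MorphismProperty.pullback_fst _ _ ‹_›
  exact hasResolution_of_isBlowup_comap (pullback.fst f (Spec.map (CommRingCat.ofHom σ))) hJ hρ hY

end Summit.ResolutionOfSingularities.ResolutionOfSingularities.Theorems

end
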